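import Summits.QuantumFields.YangMills.Theorems.PoincareLipschitzConeLinkChartIntegral
import Mathlib.MeasureTheory.Integral.Prod
import HarnessLib

/-!
# Crux `BlockLipschitzL` (stmt-QuantumFields-23533) ∕ `HistoryTailL` (stmt-QuantumFields-19936), LINE 25 «CompactnessTransfer»,
# the (GAP)∕(TM) road (H) «SU(2) currents ⇒ H-system ⇒ 8π quantum», brick (T) «CONE → PLANE TRANSPORT» —
# FILE D-EN «THE ENERGY OF THE LINK THROUGH THE CONE CHART» (row (T-3′) of px19 g8's DOOR-T)

Cell `ym3-torus` (YM ladder rung R3 = continuum SU(2) Yang–Mills on T³ — a RUNG, NOT Clay: not d = 4, not infinite volume,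
not a mass gap); WIDTH helper seat `ym3-torus-px16` g10 on px14 g7's word «px16: D-EN» (16:57:59Z), typed against px14's
FROZEN letters `LETTERS-D-rows.px14g7.txt` sha16 6d45db5d720dd832; `--supports stmt-QuantumFields-23533`; THEOREMS ONLY
(0 `def`, 0 `sorry`, default heartbeats); imports FILE A3 ✓`…PoincareLipschitzConeLinkChartIntegral` (A1's frame row, A3's
change of variables) + Mathlib (`MeasureTheory.Integral.Prod`).

THE SETTING (px14's common hypothesis block, chart form on the cone slab `S = (0, 1∕4) × E²`, chart `q ↦ q.1 • σ q.2`):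
`hHw : Gw q.2 = G_{q.1 • σ q.2} ∘L (q.1 • Dσ_{q.2})` a.e. on `S` (the link's gradient is the tangential gradient of `U` read in the
chart — px14's D3-core discharges it from dilation invariance at a good slice), `hradS : G_{q.1 • σ q.2} (σ q.2) = 0` a.e. on `S`
(radial constancy), `hGi` (finite energy on `B_{1∕4}`) and `hE : E(U; B_{1∕4}(0)) = Θ · (1∕4)` (linear central energies at `r = 1∕4`).
(`hVw`, the row for `w` itself, is NOT used by this file and therefore not taken.)

WHAT THIS FILE PROVES.  ★ `jac_mul_dens_comp_chart_ae` — POINTWISE ON THE SLAB: `(t² c(y)²) · Σᵢ‖G_{tσ(y)} eᵢ‖² = Σ_k ‖Gw_y e_k‖²`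
a.e. (A1's frame row `sum_inner_apply_single_eq_frame` at `a = b = G`, the radial term killed by `hradS`, the tangential terms read
through `hHw`: every power of `t` and every conformal factor cancels — the 2-d conformal invariance of the Dirichlet energy);
★★★ `integrable_and_integral_linkEnergy` — THE (T-3′) ROWS OF DOOR-T:
`Integrable (fun y => Σ_k ‖Gw y (e k)‖²) ∧ ∫ y, Σ_k ‖Gw y (e k)‖² = Θ` (A3's change of variables on `ball 0 (1∕4)` = the slab, then
Fubini on `volume.restrict S = (volume.restrict (Ioo 0 (1∕4))).prod volume`: `Θ∕4 = E(B_{1∕4}) = ∫_S Σ_k‖Gw e_k‖² = (1∕4) · ∫ Σ_k‖Gw e_k‖²`).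

HONEST SCOPE.  One Fubini∕change-of-variables identity; nothing of (T-1)(T-2)(T-4), (Q), (H), (F), (GAP), (TM), S1″, K1,
`MeanDeviationL`, `BlockLipschitzL`, `HistoryTailL` is proved here.  YM₃ on T³ is rung R3, not Clay; YM gap NOT proved; no summit
statement is proved here.

References: R. Schoen, K. Uhlenbeck, Invent. Math. 78 (1984) 89–100 [SchoenUhlenbeck1984] (§1: the density of a tangent map is
the energy of its link); L. C. Evans, R. F. Gariepy, Measure Theory and Fine Properties of Functions (1992) [EvansGariepy1992] (§3.4.4).
-/

set_option autoImplicit false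

noncomputable section

open MeasureTheory Set Function Filter Topology Metric
open scoped RealInnerProductSpace BigOperators ContDiff ENNReal

namespace Summit.QuantumFields.YangMills.Theorems.PoincareLipschitzConeLinkEnergy

open Summit.QuantumFields.YangMills.Theorems.PoincareLipschitzConeLinkChart

variable {c : EuclideanSpace ℝ (Fin 2) → ℝ} {σ : EuclideanSpace ℝ (Fin 2) → EuclideanSpace ℝ (Fin 3)}
  {G : EuclideanSpace ℝ (Fin 3) → (EuclideanSpace ℝ (Fin 3) →L[ℝ] EuclideanSpace ℝ (Fin 4))}
  {Gw : EuclideanSpace ℝ (Fin 2) → (EuclideanSpace ℝ (Fin 2) →L[ℝ] EuclideanSpace ℝ (Fin 4))}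

/-- The slab measure is a product: `volume.restrict ((0,1∕4) × E²) = (volume.restrict (0,1∕4)) ⊗ volume`. [folklore] -/
theorem restrict_slab_eq_prod :
    (volume.restrict (Ioo (0:ℝ) (1/4) ×ˢ (univ : Set (EuclideanSpace ℝ (Fin 2)))) :
        Measure (ℝ × EuclideanSpace ℝ (Fin 2))) =
      (volume.restrict (Ioo (0:ℝ) (1/4))).prod (volume : Measure (EuclideanSpace ℝ (Fin 2))) := by
  rw [show (volume : Measure (ℝ × EuclideanSpace ℝ (Fin 2))) = (volume : Measure ℝ).prod volume from rfl,
    ← Measure.prod_restrict, Measure.restrict_univ]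

/-- The slab's first factor has total mass `1∕4` and is nonzero. [folklore] -/
theorem restrict_Ioo_real_univ :
    (volume.restrict (Ioo (0:ℝ) (1/4))).real (univ : Set ℝ) = 1 / 4 ∧ (volume.restrict (Ioo (0:ℝ) (1/4))) ≠ 0 := by
  have h : (volume.restrict (Ioo (0:ℝ) (1/4))) (univ : Set ℝ) = ENNReal.ofReal (1 / 4) := by
    rw [Measure.restrict_apply_univ, Real.volume_Ioo, sub_zero]
  refine ⟨?_, ?_⟩
  · rw [measureReal_def, h, ENNReal.toReal_ofReal (by norm_num)]
  · intro h0
    have h1 : (volume.restrict (Ioo (0:ℝ) (1/4))) (univ : Set ℝ) = 0 := by rw [h0]; rfl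
    rw [h] at h1
    exact absurd h1 (by norm_num)

/-- ★ **THE DENSITY THROUGH THE CHART, POINTWISE**: a.e. on the slab,
`(t² · c(y)²) · Σᵢ ‖G_{tσ(y)} eᵢ‖² = Σ_k ‖Gw_y e_k‖²` — the frame row with the radial term killed by `hradS` and the tangential
terms read through `hHw`. [cite: SchoenUhlenbeck1984, §1] -/
theorem jac_mul_dens_comp_chart_ae (hc : ∀ y, c y = 2 / (1 + ‖y‖ ^ 2))
    (hσ : ∀ y, σ y = !₂[c y * y 0, c y * y 1, c y - 1])
    (hHw : ∀ᵐ q ∂(volume.restrict (Ioo (0:ℝ) (1/4) ×ˢ (univ : Set (EuclideanSpace ℝ (Fin 2))))),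
      (G (q.1 • σ q.2)).comp (q.1 • fderiv ℝ σ q.2) = Gw q.2)
    (hradS : ∀ᵐ q ∂(volume.restrict (Ioo (0:ℝ) (1/4) ×ˢ (univ : Set (EuclideanSpace ℝ (Fin 2))))),
      G (q.1 • σ q.2) (σ q.2) = 0) :
    ∀ᵐ q ∂(volume.restrict (Ioo (0:ℝ) (1/4) ×ˢ (univ : Set (EuclideanSpace ℝ (Fin 2))))),
      (q.1 ^ 2 * c q.2 ^ 2) * ∑ i : Fin 3, ‖G (q.1 • σ q.2) (EuclideanSpace.single i (1:ℝ))‖ ^ 2 =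
        ∑ k : Fin 2, ‖Gw q.2 (EuclideanSpace.single k (1:ℝ))‖ ^ 2 := by
  have hS : MeasurableSet (Ioo (0:ℝ) (1/4) ×ˢ (univ : Set (EuclideanSpace ℝ (Fin 2)))) :=
    measurableSet_Ioo.prod MeasurableSet.univ
  filter_upwards [hHw, hradS, ae_restrict_mem hS] with q hH hr hq
  have ht : 0 < q.1 := (mem_prod.1 hq).1.1
  have hc0 : c q.2 ≠ 0 := (c_pos hc q.2).ne'
  have hframe := sum_inner_apply_single_eq_frame hc hσ q.2 (G (q.1 • σ q.2)) (G (q.1 • σ q.2))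
  simp only [real_inner_self_eq_norm_sq] at hframe
  have hk : ∀ k : Fin 2, ‖Gw q.2 (EuclideanSpace.single k (1:ℝ))‖ ^ 2 =
      q.1 ^ 2 * ‖G (q.1 • σ q.2) (fderiv ℝ σ q.2 (EuclideanSpace.single k (1:ℝ)))‖ ^ 2 := by
    intro k
    rw [← hH, ContinuousLinearMap.comp_apply, _root_.smul_apply, map_smul, norm_smul, mul_pow, Real.norm_eq_abs,
      sq_abs]
  have hsum : ∑ k : Fin 2, ‖G (q.1 • σ q.2) (fderiv ℝ σ q.2 (EuclideanSpace.single k (1:ℝ)))‖ ^ 2 =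
      (q.1 ^ 2)⁻¹ * ∑ k : Fin 2, ‖Gw q.2 (EuclideanSpace.single k (1:ℝ))‖ ^ 2 := by
    rw [Finset.mul_sum]
    refine Finset.sum_congr rfl fun k _ => ?_
    rw [hk k]
    field_simp
  rw [hframe, hr, norm_zero, hsum]
  field_simp
  ring

/-- ★★★ **THE (T-3′) ROWS OF DOOR-T — THE ENERGY OF THE LINK**: under px14's chart letters on the slab `(0,1∕4) × E²`
(`hHw`, `hradS`), finite energy on `B_{1∕4}(0)` and `E(U; B_{1∕4}(0)) = Θ∕4`, the planar density `Σ_k ‖Gw e_k‖²` is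
integrable on `E²` with `∫ Σ_k ‖Gw e_k‖² = Θ` (change of variables along the cone chart + Fubini on the slab).
[cite: SchoenUhlenbeck1984, §1; EvansGariepy1992, §3.4.4] -/
theorem integrable_and_integral_linkEnergy (hc : ∀ y, c y = 2 / (1 + ‖y‖ ^ 2))
    (hσ : ∀ y, σ y = !₂[c y * y 0, c y * y 1, c y - 1])
    (hHw : ∀ᵐ q ∂(volume.restrict (Ioo (0:ℝ) (1/4) ×ˢ (univ : Set (EuclideanSpace ℝ (Fin 2))))),
      (G (q.1 • σ q.2)).comp (q.1 • fderiv ℝ σ q.2) = Gw q.2)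
    (hradS : ∀ᵐ q ∂(volume.restrict (Ioo (0:ℝ) (1/4) ×ˢ (univ : Set (EuclideanSpace ℝ (Fin 2))))),
      G (q.1 • σ q.2) (σ q.2) = 0)
    (hGi : IntegrableOn (fun x => ∑ i : Fin 3, ‖G x (EuclideanSpace.single i (1:ℝ))‖ ^ 2)
      (ball (0 : EuclideanSpace ℝ (Fin 3)) (1/4)) volume) (Θ : ℝ)
    (hE : ∫ x in ball (0 : EuclideanSpace ℝ (Fin 3)) (1/4), ∑ i : Fin 3, ‖G x (EuclideanSpace.single i (1:ℝ))‖ ^ 2 =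
      Θ * (1/4)) :
    Integrable (fun y => ∑ k : Fin 2, ‖Gw y (EuclideanSpace.single k (1:ℝ))‖ ^ 2) volume ∧
      (∫ y, ∑ k : Fin 2, ‖Gw y (EuclideanSpace.single k (1:ℝ))‖ ^ 2 = Θ) := by
  have hpt := jac_mul_dens_comp_chart_ae hc hσ hHw hradS
  have hS : MeasurableSet (Ioo (0:ℝ) (1/4) ×ˢ (univ : Set (EuclideanSpace ℝ (Fin 2)))) :=
    measurableSet_Ioo.prod MeasurableSet.univ
  -- integrability on the slab through the chart
  have hsub : {x : EuclideanSpace ℝ (Fin 3) | ‖x‖ ∈ Ioo (0:ℝ) (1/4)} ⊆ ball (0 : EuclideanSpace ℝ (Fin 3)) (1/4) := by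
    intro x hx
    rw [mem_ball_zero_iff]
    exact hx.2
  have hI1 : IntegrableOn (fun q : ℝ × EuclideanSpace ℝ (Fin 2) => (q.1 ^ 2 * c q.2 ^ 2) •
      (∑ i : Fin 3, ‖G (q.1 • σ q.2) (EuclideanSpace.single i (1:ℝ))‖ ^ 2))
      (Ioo (0:ℝ) (1/4) ×ˢ (univ : Set (EuclideanSpace ℝ (Fin 2)))) volume :=
    (integrableOn_norm_mem_iff_integrableOn_chart hc hσ measurableSet_Ioo (fun t ht => ht.1) _).1 (hGi.mono_set hsub)
  have hI2 : IntegrableOn (fun q : ℝ × EuclideanSpace ℝ (Fin 2) => ∑ k : Fin 2, ‖Gw q.2 (EuclideanSpace.single k (1:ℝ))‖ ^ 2)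
      (Ioo (0:ℝ) (1/4) ×ˢ (univ : Set (EuclideanSpace ℝ (Fin 2)))) volume := by
    refine hI1.congr_fun_ae ?_
    filter_upwards [hpt] with q hq
    rw [smul_eq_mul, hq]
  -- Fubini: integrability of the planar density
  obtain ⟨hreal, hne⟩ := restrict_Ioo_real_univ
  have hI2' : Integrable (fun q : ℝ × EuclideanSpace ℝ (Fin 2) => ∑ k : Fin 2, ‖Gw q.2 (EuclideanSpace.single k (1:ℝ))‖ ^ 2)
      ((volume.restrict (Ioo (0:ℝ) (1/4))).prod (volume : Measure (EuclideanSpace ℝ (Fin 2)))) := by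
    rw [← restrict_slab_eq_prod]
    exact hI2
  have hint : Integrable (fun y => ∑ k : Fin 2, ‖Gw y (EuclideanSpace.single k (1:ℝ))‖ ^ 2) volume :=
    Integrable.of_comp_snd (f := fun y => ∑ k : Fin 2, ‖Gw y (EuclideanSpace.single k (1:ℝ))‖ ^ 2) hI2' hne
  refine ⟨hint, ?_⟩
  -- the energy identity
  have h1 := setIntegral_ball_eq_integral_chart hc hσ (1/4)
    (fun x => ∑ i : Fin 3, ‖G x (EuclideanSpace.single i (1:ℝ))‖ ^ 2)
  have h2 : ∫ q in Ioo (0:ℝ) (1/4) ×ˢ (univ : Set (EuclideanSpace ℝ (Fin 2))), (q.1 ^ 2 * c q.2 ^ 2) •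
      (∑ i : Fin 3, ‖G (q.1 • σ q.2) (EuclideanSpace.single i (1:ℝ))‖ ^ 2) =
      ∫ q in Ioo (0:ℝ) (1/4) ×ˢ (univ : Set (EuclideanSpace ℝ (Fin 2))), ∑ k : Fin 2, ‖Gw q.2 (EuclideanSpace.single k (1:ℝ))‖ ^ 2 := by
    refine setIntegral_congr_ae hS ?_
    rw [ae_restrict_iff' hS] at hpt
    filter_upwards [hpt] with q hq hqS
    rw [smul_eq_mul, hq hqS]
  have h3 : ∫ q in Ioo (0:ℝ) (1/4) ×ˢ (univ : Set (EuclideanSpace ℝ (Fin 2))), ∑ k : Fin 2,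
      ‖Gw q.2 (EuclideanSpace.single k (1:ℝ))‖ ^ 2 = (1 / 4) * ∫ y, ∑ k : Fin 2, ‖Gw y (EuclideanSpace.single k (1:ℝ))‖ ^ 2 := by
    rw [restrict_slab_eq_prod]
    have h := integral_fun_snd (μ := volume.restrict (Ioo (0:ℝ) (1/4))) (ν := (volume : Measure (EuclideanSpace ℝ (Fin 2))))
      (fun y => ∑ k : Fin 2, ‖Gw y (EuclideanSpace.single k (1:ℝ))‖ ^ 2)
    rw [hreal, smul_eq_mul] at h
    exact h
  rw [h1, h2, h3] at hE
  linarith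

end Summit.QuantumFields.YangMills.Theorems.PoincareLipschitzConeLinkEnergy

end
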